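import Summits.NavierStokesRegularity.NavierStokesRegularity.Theses.RellichScar
import Summits.NavierStokesRegularity.NavierStokesRegularity.Theorems.ScarRigidity.Negative.LogicAndLoadBearing
import Summits.NavierStokesRegularity.NavierStokesRegularity.Theorems.RellichScarScarRigidityApexMild
import Summits.NavierStokesRegularity.NavierStokesRegularity.Theorems.RellichScarDefs
import Literature.Analysis.FluidPDE.TypeIAncientMild
import Literature.Analysis.FluidPDE.HessianLaplacian
import HarnessLib

/-!
# `ScarRigidity` — line `moment-conditioned-rellich`: the sorry-free REDUCTION of the crux to the six registered stubs
# (crux stmt-NavierStokesRegularity-11717, route RellichScar; second line lead)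

`scarRigidity_of_momentLadder`: the route decl `RellichScar.ScarRigidity` follows from the six registered stub STATEMENTS of
the line, taken here as hypotheses spelled out verbatim (S-reg `stub_apexRegularity`, S-far `stub_farFieldAllOrders`,
PL `stub_paintedLadder`, Q2 `stub_quadrupoleDefectVanishes`, HM `stub_higherMomentsVanish`, FSR `stub_flatScarRigidity`;
registry of 2026-08-16T03:50Z), together with the LANDED S1α `stub_apexMildRepresentative` of line
`finite-energy-log-convexity` (imported).  When the stubs land as theorems, the closing file is the one-liner
`scarRigidity_of_momentLadder stub_apexRegularity … stub_flatScarRigidity`.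

Glue proved here (namespace `…RellichScarScarRigidity.MomentLadder`; `farDecay_anti` lives with the defs): `allOrders_of_ladder` (the ladder closes by induction on the order: rung 1 of PL gives `FarDecay 4`,
Q2 the degree-2 moments, then alternately PL / HM), `sameScar_congr_ae` and `isBackwardSingularPoint_congr_ae` (the scar and
the singular apex pass to a.e.-equal representatives), `ae_slab_of_forall`, and the non-vacuity witness `isSolidHarmonic_coord_mul` (`y₀y₁` is a solid harmonic of degree 2).  Composition: normal form `scarRigidity_iff_pos`
(only `0 < C` carries content, `Theorems/ScarRigidity/Negative/LogicAndLoadBearing.lean`), representatives, package, transfer,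
far field, ladder, flat rigidity, transfer back.  No new definitions (vocabulary from `Theorems/RellichScarDefs.lean`).
-/

noncomputable section

open Set Filter Function MeasureTheory Metric TopologicalSpace
open scoped Topology ENNReal NNReal InnerProductSpace RealInnerProductSpace Laplacian
open Literature.Analysis.FluidPDE
open Summit.NavierStokesRegularity.NavierStokesRegularity.Theses.RellichScar
open Summit.NavierStokesRegularity.NavierStokesRegularity.Theorems.ScarRigidity.Negative

set_option linter.dupNamespace false

namespace Summit.NavierStokesRegularity.NavierStokesRegularity.Theorems.RellichScarScarRigidity

/-- Physical space. -/
local notation "ℝ³" => EuclideanSpace ℝ (Fin 3)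

/-- The open backward slab `(-∞,0) × ℝ³` (time first), as in the route file. -/
local notation "𝕊" => Literature.Analysis.FluidPDE.slab (EuclideanSpace ℝ (Fin 3)) (Set.Iio (0 : ℝ)) isOpen_Iio

namespace MomentLadder

/-- **The ladder closes by induction on the order**: rung `ℓ = 1` of PL gives `FarDecay 4`, Q2 the degree-2
moments, and alternately PL (flatness one order up) / HM (the next moments); hence flatness of every order. -/
theorem allOrders_of_ladder {V₁ V₂ : ℝ → ℝ³ → ℝ³}
    (hPL : ∀ ℓ : ℕ, 1 ≤ ℓ → (∀ ℓ' : ℕ, 2 ≤ ℓ' → ℓ' ≤ ℓ → RadiativeMomentsVanish ℓ' V₁ V₂) →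
      FarDecay (ℓ + 3) V₁ V₂)
    (hQ2 : FarDecay 4 V₁ V₂ → RadiativeMomentsVanish 2 V₁ V₂)
    (hHM : ∀ ℓ : ℕ, 3 ≤ ℓ → FarDecay (ℓ + 2) V₁ V₂ → RadiativeMomentsVanish ℓ V₁ V₂) :
    ∀ N : ℕ, FarDecay N V₁ V₂ := by
  -- all moments of degree `2 ≤ ℓ' ≤ ℓ` vanish, for every `ℓ`
  have hmom : ∀ ℓ : ℕ, ∀ ℓ' : ℕ, 2 ≤ ℓ' → ℓ' ≤ ℓ → RadiativeMomentsVanish ℓ' V₁ V₂ := by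
    intro ℓ
    induction ℓ with
    | zero => intro ℓ' h2 h0; omega
    | succ n ih =>
      intro ℓ' h2 hle
      rcases Nat.lt_or_ge ℓ' (n + 1) with hlt | hge
      · exact ih ℓ' h2 (by omega)
      · have heq : ℓ' = n + 1 := le_antisymm hle hge
        subst heq
        -- flatness of order `n + 3` from the rungs up to `n` (or rung 1 when `n ≤ 1`)
        rcases Nat.lt_or_ge n 2 with hn | hn
        · -- `n + 1 = 2`: the quadrupole
          have h1 : n = 1 := by omega
          subst h1
          refine hQ2 ?_
          exact hPL 1 le_rfl (fun ℓ' h2' h1' => by omega)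
        · have hF : FarDecay (n + 3) V₁ V₂ := hPL n (by omega) ih
          exact hHM (n + 1) (by omega) (by simpa [add_assoc, add_comm, add_left_comm] using hF)
  intro N
  have hF : FarDecay (max N 1 + 3) V₁ V₂ := hPL (max N 1) (le_max_right _ _) (hmom _)
  exact farDecay_anti (by omega) hF

/-- A.e.-equal fields on the slab have the same scar relation (the scar is an `ess sup` statement on subsets
of the slab). [folklore] -/
theorem sameScar_congr_ae {u₁ u₂ V₁ V₂ : ℝ → ℝ³ → ℝ³}
    (h₁ : uncurry V₁ =ᵐ[volume.restrict (Iio (0 : ℝ) ×ˢ (univ : Set ℝ³))] uncurry u₁)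
    (h₂ : uncurry V₂ =ᵐ[volume.restrict (Iio (0 : ℝ) ×ˢ (univ : Set ℝ³))] uncurry u₂)
    (h : SameScar u₁ u₂) : SameScar V₁ V₂ := by
  intro K hK h0
  refine (h K hK h0).congr' ?_
  filter_upwards [self_mem_nhdsWithin] with δ _
  have hsub : Ioo (-δ) 0 ×ˢ K ⊆ Iio (0 : ℝ) ×ˢ (univ : Set ℝ³) := fun z hz => ⟨hz.1.2, trivial⟩
  have h₁' := ae_restrict_of_ae_restrict_of_subset hsub h₁
  have h₂' := ae_restrict_of_ae_restrict_of_subset hsub h₂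
  refine eLpNorm_congr_ae ?_
  filter_upwards [h₁', h₂'] with z hz₁ hz₂
  simp only [Pi.sub_apply, hz₁, hz₂]

/-- A.e.-equal fields on the slab have the same backward-singular behaviour at the origin (the backward cylinders
`Q_r(0,0)` lie in the slab). [folklore] -/
theorem isBackwardSingularPoint_congr_ae {u V : ℝ → ℝ³ → ℝ³}
    (hV : uncurry V =ᵐ[volume.restrict (Iio (0 : ℝ) ×ˢ (univ : Set ℝ³))] uncurry u)
    (hs : IsBackwardSingularPoint u 0) : IsBackwardSingularPoint V 0 := by
  intro r hr
  have hsub : parabolicCylinder r (0 : ℝ × ℝ³) ⊆ Iio (0 : ℝ) ×ˢ (univ : Set ℝ³) := by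
    intro z hz
    rw [mem_parabolicCylinder] at hz
    exact ⟨by simpa using hz.1.2, trivial⟩
  have hae := ae_restrict_of_ae_restrict_of_subset hsub hV
  rw [eLpNorm_congr_ae hae]
  exact hs r hr

/-- A pointwise statement on `t < 0` holds a.e. on the slab `Iio 0 ×ˢ univ`. [folklore] -/
theorem ae_slab_of_forall {P : ℝ × ℝ³ → Prop} (h : ∀ t < 0, ∀ x : ℝ³, P (t, x)) :
    ∀ᵐ z ∂(volume.restrict (Iio (0 : ℝ) ×ˢ (univ : Set ℝ³))), P z := by
  filter_upwards [ae_restrict_mem (measurableSet_Iio.prod MeasurableSet.univ)] with z hz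
  exact h z.1 (mem_prod.1 hz).1 z.2

/-- A continuous linear functional on `ℝ³` has vanishing Laplacian. [folklore] -/
theorem laplacian_clm_eq_zero (l : ℝ³ →L[ℝ] ℝ) (x : ℝ³) : (Δ (fun y => l y)) x = 0 := by
  rw [Literature.Analysis.FluidPDE.laplacian_eq_sum_fderiv_fderiv (EuclideanSpace.basisFun (Fin 3) ℝ)
    (l.contDiff.of_le le_top) x]
  refine Finset.sum_eq_zero fun i _ => ?_
  have : (fun y : ℝ³ => fderiv ℝ (fun y => l y) y ((EuclideanSpace.basisFun (Fin 3) ℝ) i)) =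
      fun _ => l ((EuclideanSpace.basisFun (Fin 3) ℝ) i) := by
    funext y
    rw [show (fun y => l y) = (l : ℝ³ → ℝ) from rfl, ContinuousLinearMap.fderiv]
  rw [this]
  simp

/-- **Non-vacuity of the moment conditions**: `y ↦ y₀y₁` is a solid harmonic of degree `2`, so `RadiativeMomentsVanish 2 V₁ V₂`
asserts in particular `∫ ((V₁)₀(V₁)₁ − (V₂)₀(V₂)₁)(t,x) dx = 0` — an off-diagonal entry of the trace-free Reynolds-stress defect. [folklore] -/
theorem isSolidHarmonic_coord_mul : IsSolidHarmonic 2 (fun y : ℝ³ => y 0 * y 1) := by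
  set l₀ : ℝ³ →L[ℝ] ℝ := EuclideanSpace.proj (0 : Fin 3) with hl₀
  set l₁ : ℝ³ →L[ℝ] ℝ := EuclideanSpace.proj (1 : Fin 3) with hl₁
  have h0 : ∀ y : ℝ³, l₀ y = y 0 := fun y => rfl
  have h1 : ∀ y : ℝ³, l₁ y = y 1 := fun y => rfl
  refine ⟨?_, ?_, ?_⟩
  · have : (fun y : ℝ³ => y 0 * y 1) = fun y => l₀ y * l₁ y := by funext y; rw [h0, h1]
    rw [this]
    exact l₀.contDiff.mul l₁.contDiff
  · intro r x _
    simp only [PiLp.smul_apply, smul_eq_mul]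
    ring
  · intro x
    have hf : ContDiff ℝ 2 (fun y : ℝ³ => l₀ y) := l₀.contDiff.of_le le_top
    have hg : ContDiff ℝ 2 (fun y : ℝ³ => l₁ y) := l₁.contDiff.of_le le_top
    have : (fun y : ℝ³ => y 0 * y 1) = fun y => (fun y => l₀ y) y * (fun y => l₁ y) y := by
      funext y; simp only [h0, h1]
    rw [this, Literature.Analysis.FluidPDE.laplacian_mul_eq (EuclideanSpace.basisFun (Fin 3) ℝ) hf hg x,
      laplacian_clm_eq_zero, laplacian_clm_eq_zero]
    have hd0 : ∀ i, fderiv ℝ (fun y => l₀ y) x ((EuclideanSpace.basisFun (Fin 3) ℝ) i) = if i = 0 then 1 else 0 := by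
      intro i
      rw [show (fun y => l₀ y) = (l₀ : ℝ³ → ℝ) from rfl, ContinuousLinearMap.fderiv, h0]
      simp [EuclideanSpace.basisFun_apply, eq_comm]
    have hd1 : ∀ i, fderiv ℝ (fun y => l₁ y) x ((EuclideanSpace.basisFun (Fin 3) ℝ) i) = if i = 1 then 1 else 0 := by
      intro i
      rw [show (fun y => l₁ y) = (l₁ : ℝ³ → ℝ) from rfl, ContinuousLinearMap.fderiv, h1]
      simp [EuclideanSpace.basisFun_apply, eq_comm]
    simp only [hd0, hd1, mul_zero, zero_add]
    simp

end MomentLadder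

open MomentLadder in
/-- **REDUCTION OF THE CRUX TO THE LINE'S STUBS.**  `ScarRigidity` follows from the six registered stub statements of line
`moment-conditioned-rellich` (hypotheses, verbatim the registered signatures) and the landed S1α
`stub_apexMildRepresentative`: only `0 < C` carries content; take Type-I ancient mild representatives `V₁, V₂` of the two
profiles (S1α), their Leray pressures and scale-invariant packages (S-reg), move the scar and the singular apex to the
representatives (a.e. invariance), get cubic flatness from the scar (S-far), flatness of every order from the ladder
(PL, Q2, HM by `allOrders_of_ladder`), equality of the representatives (FSR), and transfer back along the a.e. equalities. -/
theorem scarRigidity_of_momentLadder :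
    (∀ (V : ℝ → ℝ³ → ℝ³) (C : ℝ), 0 < C → IsTypeIAncientMild C V → HasTypeIDecay C V → ∃ Q : ℝ → ℝ³ → ℝ, IsClassicalNSSolutionOn (Iio (0 : ℝ)) 1 0 V Q ∧ ScaleInvariantBounds V Q) →
    (∀ (V₁ V₂ : ℝ → ℝ³ → ℝ³) (Q₁ Q₂ : ℝ → ℝ³ → ℝ), IsClassicalNSSolutionOn (Iio (0 : ℝ)) 1 0 V₁ Q₁ → IsClassicalNSSolutionOn (Iio (0 : ℝ)) 1 0 V₂ Q₂ → ScaleInvariantBounds V₁ Q₁ → ScaleInvariantBounds V₂ Q₂ → SameScar V₁ V₂ → FarDecay 3 V₁ V₂) →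
    (∀ (V₁ V₂ : ℝ → ℝ³ → ℝ³) (Q₁ Q₂ : ℝ → ℝ³ → ℝ) (C : ℝ) (ℓ : ℕ), 0 < C → 1 ≤ ℓ → IsClassicalNSSolutionOn (Iio (0 : ℝ)) 1 0 V₁ Q₁ → IsClassicalNSSolutionOn (Iio (0 : ℝ)) 1 0 V₂ Q₂ → HasTypeIDecay C V₁ → HasTypeIDecay C V₂ → ScaleInvariantBounds V₁ Q₁ → ScaleInvariantBounds V₂ Q₂ → FarDecay 3 V₁ V₂ → (∀ ℓ' : ℕ, 2 ≤ ℓ' → ℓ' ≤ ℓ → RadiativeMomentsVanish ℓ' V₁ V₂) → FarDecay (ℓ + 3) V₁ V₂) →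
    (∀ (V₁ V₂ : ℝ → ℝ³ → ℝ³) (Q₁ Q₂ : ℝ → ℝ³ → ℝ) (C : ℝ), 0 < C → IsTypeIAncientMild C V₁ → IsTypeIAncientMild C V₂ → HasTypeIDecay C V₁ → HasTypeIDecay C V₂ → IsClassicalNSSolutionOn (Iio (0 : ℝ)) 1 0 V₁ Q₁ → IsClassicalNSSolutionOn (Iio (0 : ℝ)) 1 0 V₂ Q₂ → ScaleInvariantBounds V₁ Q₁ → ScaleInvariantBounds V₂ Q₂ → IsBackwardSingularPoint V₁ 0 → IsBackwardSingularPoint V₂ 0 → FarDecay 4 V₁ V₂ → RadiativeMomentsVanish 2 V₁ V₂) →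
    (∀ (V₁ V₂ : ℝ → ℝ³ → ℝ³) (Q₁ Q₂ : ℝ → ℝ³ → ℝ) (C : ℝ) (ℓ : ℕ), 0 < C → 3 ≤ ℓ → IsTypeIAncientMild C V₁ → IsTypeIAncientMild C V₂ → HasTypeIDecay C V₁ → HasTypeIDecay C V₂ → IsClassicalNSSolutionOn (Iio (0 : ℝ)) 1 0 V₁ Q₁ → IsClassicalNSSolutionOn (Iio (0 : ℝ)) 1 0 V₂ Q₂ → ScaleInvariantBounds V₁ Q₁ → ScaleInvariantBounds V₂ Q₂ → IsBackwardSingularPoint V₁ 0 → IsBackwardSingularPoint V₂ 0 → FarDecay (ℓ + 2) V₁ V₂ → RadiativeMomentsVanish ℓ V₁ V₂) →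
    (∀ (V₁ V₂ : ℝ → ℝ³ → ℝ³) (Q₁ Q₂ : ℝ → ℝ³ → ℝ) (C : ℝ), 0 < C → IsTypeIAncientMild C V₁ → IsTypeIAncientMild C V₂ → HasTypeIDecay C V₁ → HasTypeIDecay C V₂ → IsClassicalNSSolutionOn (Iio (0 : ℝ)) 1 0 V₁ Q₁ → IsClassicalNSSolutionOn (Iio (0 : ℝ)) 1 0 V₂ Q₂ → ScaleInvariantBounds V₁ Q₁ → ScaleInvariantBounds V₂ Q₂ → IsBackwardSingularPoint V₁ 0 → IsBackwardSingularPoint V₂ 0 → (∀ N : ℕ, FarDecay N V₁ V₂) → ∀ t < 0, ∀ x : ℝ³, V₁ t x = V₂ t x) →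
    ScarRigidity := by
  intro hreg hfar hPL hQ2 hHM hFSR
  rw [scarRigidity_iff_pos]
  intro C hC u₁ p₁ G₁ u₂ p₂ G₂ hs₁ hg₁ hI₁ hd₁ hs₂ hg₂ hI₂ hd₂ hsing₁ hsing₂ hscar
  obtain ⟨V₁, hae₁, hm₁, hdV₁⟩ := stub_apexMildRepresentative u₁ p₁ G₁ C hC hs₁ hg₁ hI₁ hd₁
  obtain ⟨V₂, hae₂, hm₂, hdV₂⟩ := stub_apexMildRepresentative u₂ p₂ G₂ C hC hs₂ hg₂ hI₂ hd₂
  obtain ⟨Q₁, hcl₁, hB₁⟩ := hreg V₁ C hC hm₁ hdV₁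
  obtain ⟨Q₂, hcl₂, hB₂⟩ := hreg V₂ C hC hm₂ hdV₂
  have hscarV : SameScar V₁ V₂ := sameScar_congr_ae hae₁ hae₂ hscar
  have hsV₁ : IsBackwardSingularPoint V₁ 0 := isBackwardSingularPoint_congr_ae hae₁ hsing₁
  have hsV₂ : IsBackwardSingularPoint V₂ 0 := isBackwardSingularPoint_congr_ae hae₂ hsing₂
  have hF3 : FarDecay 3 V₁ V₂ := hfar V₁ V₂ Q₁ Q₂ hcl₁ hcl₂ hB₁ hB₂ hscarV
  have hall : ∀ N : ℕ, FarDecay N V₁ V₂ :=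
    allOrders_of_ladder
      (fun ℓ hℓ hmom => hPL V₁ V₂ Q₁ Q₂ C ℓ hC hℓ hcl₁ hcl₂ hdV₁ hdV₂ hB₁ hB₂ hF3 hmom)
      (fun hF4 => hQ2 V₁ V₂ Q₁ Q₂ C hC hm₁ hm₂ hdV₁ hdV₂ hcl₁ hcl₂ hB₁ hB₂ hsV₁ hsV₂ hF4)
      (fun ℓ hℓ hF => hHM V₁ V₂ Q₁ Q₂ C ℓ hC hℓ hm₁ hm₂ hdV₁ hdV₂ hcl₁ hcl₂ hB₁ hB₂ hsV₁ hsV₂ hF)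
  have heq := hFSR V₁ V₂ Q₁ Q₂ C hC hm₁ hm₂ hdV₁ hdV₂ hcl₁ hcl₂ hB₁ hB₂ hsV₁ hsV₂ hall
  have hV : uncurry V₁ =ᵐ[volume.restrict (Iio (0 : ℝ) ×ˢ (univ : Set ℝ³))] uncurry V₂ :=
    ae_slab_of_forall (P := fun z => uncurry V₁ z = uncurry V₂ z) fun t ht x => heq t ht x
  exact (hae₁.symm.trans hV).trans hae₂

end Summit.NavierStokesRegularity.NavierStokesRegularity.Theorems.RellichScarScarRigidity

end
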